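/-
Copyright (c) 2026 the pub-hodgecm-mathlib formalisation cell (harness21).  Prover seat hodgecm-mathlib-F0P3a-p04 (g19): road «S3-ram» (LEAD F0P3a-plan (g13); junction
pen F0P3a-p01 (g17); S45 supplier `row_S45_hyperbolic`, organ (V0) of HYP-PLAN v1; owner F0P3a-p06 (g15)); 2026-09-02.
-/
import Literature.NumberTheory.Automorphic.UnitaryLatticeTreeRegionUpClosedRamified            -- ★ S1 ED. 2 (F0P3-p04): `exists_parent_grandparent_lev_of_neg`
import Literature.NumberTheory.Automorphic.UnitaryLatticeTreeIsocelesRegionLinesRamified          -- ★ p847884 (F0P3-p03): keyed LINE TEST `lev_iff_v_pairing_lt_one_of_adj_keyed`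
import Literature.NumberTheory.Automorphic.UnitaryLatticeTreeSelfDualTransitiveTame             -- ★ `exists_latticeGraphIso_root_eq_of_v_two`
import Literature.NumberTheory.Automorphic.UnitaryLatticeTreeFixedChildCountTransportRamified   -- ★ `mem_neighborSet_latticeGraphIso_root_iff`, `latticeGraphIso_mul_apply`
import Literature.NumberTheory.Automorphic.UnitaryLatticeTreeFixedGrandchildFrameRamified       -- ★ `latticeGraphIso_root_eq_of_mem_unitaryInt`
import Literature.NumberTheory.Automorphic.UnitaryLatticeTreeStarOfInvolution                  -- ★ alternation `isSelfDualLattice_iff_not_isSelfDualLattice_of_adj_of_v`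
import Literature.NumberTheory.Automorphic.UnitaryLatticeTreeBlockGluing                       -- ★ `v_pairing_comm_of_hermitian`
import Literature.NumberTheory.Automorphic.UnitaryGroupRankOneBigCell                          -- ★ `antidiagonal_three_over_eq`
import HarnessLib

/-!
# The lattice graph of a hermitian space — THE ISOCELES REGION: EVERY NON-ROOT REGION VERTEX HAS A UNITARY FRAME ADAPTED TO ITS INWARD CHILD (tame-ramified place)
# (Bruhat–Tits 1972 §10; Kottwitz 1986 §3; Serre, *Trees* II.1.1)

Topic `NumberTheory/Automorphic`; namespace `Literature.NumberTheory.Automorphic.UnitaryLatticeTree`.  THEOREMS ONLY (no definition, no instance, no notation, no named fact,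
no `sorry`); kernel lane `--supports stmt-HodgeConjecture-24833`.  Cell `pub/hodgecm-mathlib` (D-0151), crux H413; road «S3-ram» (Literature seeding, count-neutral); junction
(J★), ISOCELES wave, supplier `row_S45_hyperbolic` (S45 v4), organ **(V0) of HYP-PLAN v1** (`F0/P3a/F0P3a-p04/g19/hyp/HYP-PLAN.v1…md`): the frame hypothesis of (V1)
★-filed `isotropicValue_eq_vertexShape_of_region` (`UnitaryLatticeTreeIsocelesVertexShapeRamified`).

**`exists_adaptedFrame_of_mem_region`**: in the isoceles setting (eigenframe `A`, integral with integral inverse, `|s_i − 1| ≤ |ϖ|^{d₀}`, isolated `i₀`, close-pair gap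
`|ϖ|^{d₀+2s'}`), every `γ`-fixed self-dual REGION vertex `v ≠ r₀` (`(γ−1)v ≤ ϖ^{d₀}v`) is `v = u·r₀` for a unitary `u` whose first child `u·N₁` is the INWARD child of `v`
(`Adj v (u·N₁)`, `dist(r₀, u·N₁) + 1 = dist(r₀, v)`) and which is ADAPTED: `|⟨u_{i₀}, u e₀⟩| < 1` and `|⟨ϖ^{s'}u_k, u e₀⟩| < 1`.  PROOF: the grandparent `g` of `v` lies in
the region (★ S1 `exists_parent_grandparent_lev_of_neg`), `v = u₀·r₀` (★ transitivity), the parent is `(u₀κ₁)·N₁` with `κ₁ ∈ K₀` (★ root-star keying), `u := u₀κ₁`, and the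
★ keyed LINE TEST at `κ = 1` with far vertex `g` (self-dual by alternation, `g ≠ v`) turns `(γ−1)g ≤ ϖ^{d₀}g` into the two inequalities (hermitian symmetry of `J₀` swaps
the arguments).

HONEST LABEL: HC_CM is proved only modulo the 2 remaining named inputs (hLiu418 24832, h413 24833) until rung 0 closes; nothing printed is asserted here (bookkeeping over ★
results); «S3-ram» has no books consequence.

## References
* [BruhatTits1972] F. Bruhat, J. Tits, *Groupes réductifs sur un corps local I*, Publ. Math. IHÉS 41 (1972), §10 (lattice models of the rank-one building).
* [Kottwitz1986] R. E. Kottwitz, *Base change for unit elements of Hecke algebras*, Compositio Math. 60 (1986), §3 (fixed lattices of a torus element).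
* [Serre1980Trees] J.-P. Serre, *Trees* (1980), Ch. II §1.1 (lattices, neighbours, distance from a base lattice).
-/

set_option autoImplicit false

noncomputable section

open scoped Valued WithZero Matrix MatrixGroups

namespace Literature.NumberTheory.Automorphic.UnitaryLatticeTree

open Literature.NumberTheory.Automorphic Literature.NumberTheory.Automorphic.HermitianLattice

variable {K : Type*} [Field K] [Valued K ℤᵐ⁰] {σ : K →+* K} {ϖ : K}

omit [Valued K ℤᵐ⁰] in
/-- `J₀ = antidiag(1,1,1)` is `σ`-hermitian for any ring hom `σ` (its entries are `0`, `1`). [cite: BruhatTits1972, §10] -/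
theorem map_antidiagonal_three_over_apply_eq (σ : K →+* K) (a b : Fin 3) : σ (((StdForm.antidiagonal 3).over K) a b) = ((StdForm.antidiagonal 3).over K) b a := by
  rw [UnitaryGroup.antidiagonal_three_over_eq]
  fin_cases a <;> fin_cases b <;> simp

/-- **(V0) EVERY NON-ROOT REGION VERTEX HAS A UNITARY FRAME ADAPTED TO ITS INWARD CHILD.** [cite: Kottwitz1986, §3] [cite: BruhatTits1972, §10] [cite: Serre1980Trees, II.1.1] -/
theorem exists_adaptedFrame_of_mem_region (hσ : ∀ x, σ (σ x) = x) (hvσ : ∀ a, Valued.v (σ a) = Valued.v a) (hσϖ : σ ϖ = -ϖ)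
    (hϖ : Valued.v ϖ = WithZero.exp (-1 : ℤ)) (hres : ∀ x : K, Valued.v x ≤ 1 → Valued.v (σ x - x) < 1) (h2 : Valued.v (2 : K) = 1)
    (hnorm : ∀ u : K, σ u = u → Valued.v (u - 1) < 1 → ∃ z : K, z * σ z = u ∧ Valued.v (z - 1) ≤ Valued.v (u - 1))
    [ValuativeRel K] [(Valued.v : Valuation K ℤᵐ⁰).Compatible]
    (hT : (latticeGraph σ ϖ ((StdForm.antidiagonal 3).over K)).IsTree)
    {γ : unitaryGroupOfForm σ ((StdForm.antidiagonal 3).over K)} (hγ0 : γ ∈ unitaryInt σ ((StdForm.antidiagonal 3).over K))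
    (d : Fin 3 → K) (hd : ∀ i, Valued.v (d i) = 1)
    (A : GL (Fin 3) K) (hA : IsIntMatrix (A : Matrix (Fin 3) (Fin 3) K)) (hA' : IsIntMatrix ((A⁻¹ : GL (Fin 3) K) : Matrix (Fin 3) (Fin 3) K))
    (hdA : Matrix.diagonal d = (-(Matrix.diagonal d).det) • formCongr σ A ((StdForm.antidiagonal 3).over K))
    (s : Fin 3 → K) (hγA : ((γ : GL (Fin 3) K) : Matrix (Fin 3) (Fin 3) K) = (A : Matrix (Fin 3) (Fin 3) K) * Matrix.diagonal s * ((A⁻¹ : GL (Fin 3) K) : Matrix (Fin 3) (Fin 3) K))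
    (i₀ : Fin 3) {d₀ : ℕ} (he : ∀ i, Valued.v (s i - 1) ≤ Valued.v ϖ ^ d₀) (hiso : ∀ m, m ≠ i₀ → Valued.v (s i₀ - s m) = Valued.v ϖ ^ d₀)
    {s' : ℕ} (hgap : ∀ j k, j ≠ i₀ → k ≠ i₀ → j ≠ k → Valued.v (s j - s k) = Valued.v ϖ ^ (d₀ + 2 * s')) {k : Fin 3} (hk : k ≠ i₀)
    {v : {M : Submodule 𝒪[K] (Fin 3 → K) // IsVertex σ ϖ ((StdForm.antidiagonal 3).over K) M}} (hv : IsSelfDualLattice σ ϖ ((StdForm.antidiagonal 3).over K) v.1) (hvr : v ≠ ⟨stdLattice K 3, 0, isSelfDualLattice_stdLattice_three_of_v hϖ⟩) (hfix : latticeGraphIso σ ϖ ((StdForm.antidiagonal 3).over K) γ v = v) (hvR : v.1.map ((Matrix.toLin' (((γ : GL (Fin 3) K) : Matrix (Fin 3) (Fin 3) K) - 1)).restrictScalars 𝒪[K]) ≤ scaleLattice (ϖ ^ d₀) v.1) :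
    ∃ u : unitaryGroupOfForm σ ((StdForm.antidiagonal 3).over K), v = latticeGraphIso σ ϖ ((StdForm.antidiagonal 3).over K) u ⟨stdLattice K 3, 0, isSelfDualLattice_stdLattice_three_of_v hϖ⟩ ∧
      (latticeGraph σ ϖ ((StdForm.antidiagonal 3).over K)).Adj v (latticeGraphIso σ ϖ ((StdForm.antidiagonal 3).over K) u ⟨latt (Matrix.diagonal ![(1 : K), 1, ϖ]), 2, isVertexLattice_two_N₁_of_neg hσϖ hϖ⟩) ∧
      (latticeGraph σ ϖ ((StdForm.antidiagonal 3).over K)).dist ⟨stdLattice K 3, 0, isSelfDualLattice_stdLattice_three_of_v hϖ⟩ (latticeGraphIso σ ϖ ((StdForm.antidiagonal 3).over K) u ⟨latt (Matrix.diagonal ![(1 : K), 1, ϖ]), 2, isVertexLattice_two_N₁_of_neg hσϖ hϖ⟩) + 1 = (latticeGraph σ ϖ ((StdForm.antidiagonal 3).over K)).dist ⟨stdLattice K 3, 0, isSelfDualLattice_stdLattice_three_of_v hϖ⟩ v ∧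
      Valued.v (pairing σ ((StdForm.antidiagonal 3).over K) ((A : Matrix (Fin 3) (Fin 3) K) *ᵥ Pi.single i₀ 1) (((u : GL (Fin 3) K) : Matrix (Fin 3) (Fin 3) K) *ᵥ Pi.single 0 1)) < 1 ∧
      Valued.v (pairing σ ((StdForm.antidiagonal 3).over K) (ϖ ^ s' • ((A : Matrix (Fin 3) (Fin 3) K) *ᵥ Pi.single k 1)) (((u : GL (Fin 3) K) : Matrix (Fin 3) (Fin 3) K) *ᵥ Pi.single 0 1)) < 1 := by
  -- the parent `p` and a grandparent-side far vertex `g` in the region (★ S1)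
  obtain ⟨p, g, hvp, hpdist, hpg, hgv, hgR⟩ :=
    exists_parent_grandparent_lev_of_neg hσ hvσ hσϖ hϖ hres h2 hnorm hT hγ0 A hA hA' s hγA he hv hvr hfix hvR
  -- the frame: `v = u₀·r₀`, `p = (u₀κ₁)·N₁`
  obtain ⟨u₀, hu₀⟩ := exists_latticeGraphIso_root_eq_of_v_two hσ hvσ hϖ h2 v hv (isSelfDualLattice_stdLattice_three_of_v hϖ)
  have hpmem : p ∈ (latticeGraph σ ϖ ((StdForm.antidiagonal 3).over K)).neighborSet (latticeGraphIso σ ϖ ((StdForm.antidiagonal 3).over K) u₀ ⟨stdLattice K 3, 0, isSelfDualLattice_stdLattice_three_of_v hϖ⟩) := by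
    rw [SimpleGraph.mem_neighborSet, hu₀]; exact hvp
  obtain ⟨κ₁, hκ₁, hp⟩ := (mem_neighborSet_latticeGraphIso_root_iff hσ hvσ hσϖ hϖ h2 u₀ p).1 hpmem
  have hvu : v = latticeGraphIso σ ϖ ((StdForm.antidiagonal 3).over K) (u₀ * κ₁) ⟨stdLattice K 3, 0, isSelfDualLattice_stdLattice_three_of_v hϖ⟩ := by
    rw [latticeGraphIso_mul_apply, latticeGraphIso_root_eq_of_mem_unitaryInt hϖ hκ₁, hu₀]
  -- `g` is self-dual (two steps of the alternation)
  have hpsd : ¬ IsSelfDualLattice σ ϖ ((StdForm.antidiagonal 3).over K) p.1 := (isSelfDualLattice_iff_not_isSelfDualLattice_of_adj_of_v hvσ hϖ hvp).1 hv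
  have hgsd : IsSelfDualLattice σ ϖ ((StdForm.antidiagonal 3).over K) g.1 := by
    by_contra hg'
    exact hpsd ((isSelfDualLattice_iff_not_isSelfDualLattice_of_adj_of_v hvσ hϖ hpg).2 hg')
  -- the keyed LINE TEST at `κ = 1` with far vertex `g`
  have hcw : (latticeGraph σ ϖ ((StdForm.antidiagonal 3).over K)).Adj (latticeGraphIso σ ϖ ((StdForm.antidiagonal 3).over K) (u₀ * κ₁ * 1) ⟨latt (Matrix.diagonal ![(1 : K), 1, ϖ]), 2, isVertexLattice_two_N₁_of_neg hσϖ hϖ⟩) g := by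
    rw [mul_one, ← hp]; exact hpg
  have hlt := (lev_iff_v_pairing_lt_one_of_adj_keyed hσ hvσ hσϖ hϖ A hd hdA s hγA i₀ he hiso hgap hk (u₀ * κ₁) hvu hvR 1 (Subgroup.one_mem _) hgsd hgv hcw).1 hgR
  rw [mul_one] at hlt
  have hJ := map_antidiagonal_three_over_apply_eq (K := K) σ
  refine ⟨u₀ * κ₁, hvu, hp ▸ hvp, by rw [← hp]; exact hpdist, ?_, ?_⟩
  · rw [v_pairing_comm_of_hermitian hvσ hσ hJ]; exact hlt.1
  · rw [v_pairing_comm_of_hermitian hvσ hσ hJ]; exact hlt.2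

/-- **(V0-root) AN ADAPTED FRAME AT THE ROOT**: a root child `(1·κ₁)·N₁` (`κ₁ ∈ K₀`) that is a REGION DIRECTION (the two pairings of the ★ keyed LINE TEST are `< 1`) IS an
adapted frame `u := κ₁` of `r₀ = κ₁·r₀` in the sense of (V1) (`|⟨u_{i₀}, κ₁e₀⟩| < 1`, `|⟨ϖ^{s'}u_k, κ₁e₀⟩| < 1`, arguments swapped by hermitian symmetry).  In the
hyperbolic configuration such a `κ₁` exists (two region directions at the root). [cite: Kottwitz1986, §3] [cite: BruhatTits1972, §10] -/
theorem exists_adaptedFrame_root_of_regDir (hσ : ∀ x, σ (σ x) = x) (hvσ : ∀ a, Valued.v (σ a) = Valued.v a)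
    (hϖ : Valued.v ϖ = WithZero.exp (-1 : ℤ))
    (A : GL (Fin 3) K) (i₀ : Fin 3) (s' : ℕ) (k : Fin 3)
    {κ₁ : unitaryGroupOfForm σ ((StdForm.antidiagonal 3).over K)} (hκ₁ : κ₁ ∈ unitaryInt σ ((StdForm.antidiagonal 3).over K))
    (hreg : Valued.v (pairing σ ((StdForm.antidiagonal 3).over K) ((((1 * κ₁ : unitaryGroupOfForm σ ((StdForm.antidiagonal 3).over K)) : GL (Fin 3) K) : Matrix (Fin 3) (Fin 3) K) *ᵥ Pi.single 0 1) ((A : Matrix (Fin 3) (Fin 3) K) *ᵥ Pi.single i₀ 1)) < 1 ∧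
      Valued.v (pairing σ ((StdForm.antidiagonal 3).over K) ((((1 * κ₁ : unitaryGroupOfForm σ ((StdForm.antidiagonal 3).over K)) : GL (Fin 3) K) : Matrix (Fin 3) (Fin 3) K) *ᵥ Pi.single 0 1) (ϖ ^ s' • ((A : Matrix (Fin 3) (Fin 3) K) *ᵥ Pi.single k 1))) < 1) :
    ∃ u : unitaryGroupOfForm σ ((StdForm.antidiagonal 3).over K), (⟨stdLattice K 3, 0, isSelfDualLattice_stdLattice_three_of_v hϖ⟩ : {M : Submodule 𝒪[K] (Fin 3 → K) // IsVertex σ ϖ ((StdForm.antidiagonal 3).over K) M}) = latticeGraphIso σ ϖ ((StdForm.antidiagonal 3).over K) u ⟨stdLattice K 3, 0, isSelfDualLattice_stdLattice_three_of_v hϖ⟩ ∧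
      Valued.v (pairing σ ((StdForm.antidiagonal 3).over K) ((A : Matrix (Fin 3) (Fin 3) K) *ᵥ Pi.single i₀ 1) (((u : GL (Fin 3) K) : Matrix (Fin 3) (Fin 3) K) *ᵥ Pi.single 0 1)) < 1 ∧
      Valued.v (pairing σ ((StdForm.antidiagonal 3).over K) (ϖ ^ s' • ((A : Matrix (Fin 3) (Fin 3) K) *ᵥ Pi.single k 1)) (((u : GL (Fin 3) K) : Matrix (Fin 3) (Fin 3) K) *ᵥ Pi.single 0 1)) < 1 := by
  rw [one_mul] at hreg
  have hJ := map_antidiagonal_three_over_apply_eq (K := K) σ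
  refine ⟨κ₁, (latticeGraphIso_root_eq_of_mem_unitaryInt hϖ hκ₁).symm, ?_, ?_⟩
  · rw [v_pairing_comm_of_hermitian hvσ hσ hJ]; exact hreg.1
  · rw [v_pairing_comm_of_hermitian hvσ hσ hJ]; exact hreg.2

end Literature.NumberTheory.Automorphic.UnitaryLatticeTree

end
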